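import Summits.CriticalPhenomena.PercolationContinuityZ3.Theorems.FK.MagnetizationFieldDerivative
import Mathlib.MeasureTheory.Integral.IntervalIntegral.FundThmCalculus
import HarnessLib

/-!
# THE SUSCEPTIBILITY SUM RULE `β ∫_a^b σ²(β,t) dt = m(β,b) − m(β,a)` AND THE SHARP GHS BOUND `σ²(β,h) ≤ (m(β,h) − m*(β))/(βh)`
# (integrated form of Ellis 2006, Lemma V.7.4 / eq. (5.28); Friedli–Velenik 2017, Remark 3.41)

Claimed R42 (8)(c) in the cell INBOX at 2026-08-28T23:16:28Z by fkp-10a gen 356 (NEW CLAIM #3 of the gen), addressed to coordinator fk-4 gen 283 (seated 21:31Z 2026-08-28 by l.8554; R157 / R158 in force); lineage row FO-10a-g356s (self-suggested), package g356-sumrules, label SR-A.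
Helper file of the `fk-continuity` build cell (bschramm lane; `--supports stmt-CriticalPhenomena-4575`); builds on
p205010 (kernel theorem, internal audit signed; external expert review pending). No definitions, no named facts, no
sorries; standard axioms. UNCONDITIONAL (nearest-neighbour Ising model on `ℤ^d`, every `d`).

With `m(h) = magnetizationInField d β h` (concave and nondecreasing on `[0,∞)`, right derivative `β σ²(β,h)` at every
`h > 0` — `MagnetizationFieldDerivative`) and `σ²(β,h) = Σ'_z (⟨σ_{{0}∆{z}}⟩⁺_{β,h} − ⟨σ_0⟩⁺_{β,h}⟨σ_z⟩⁺_{β,h})`: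

* **`tsum_plusTruncated_le_sub_div`** — THE SHARP GHS BOUND: `σ²(β,h) ≤ (m(β,h) − m*(β))/(β h)` for `β > 0`, `h > 0`
  (the lower chord bound at the pair `(0, h)`); hence `tsum_plusTruncated_le_one_sub_div`:
  `σ²(β,h) ≤ (1 − m*(β))/(βh) ≤ 1/(βh)` — the constant `4` of Ellis Thm. V.7.2 (b) / `tsum_plusTruncated_le_of_pos_field`
  (`IsingPositiveFieldCLT`) improved to `1 − m*(β)`;
* `antitoneOn_slope_magnetizationInField_zero` — `h ↦ (m(β,h) − m*(β))/h` is nonincreasing on `(0,∞)` (concavity);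
* `intervalIntegrable_tsum_plusTruncated` — `σ²(β,·)`, nonincreasing on `(0,∞)`, is integrable on every `[a,b] ⊂ (0,∞)`;
* **`integral_mul_tsum_plusTruncated_eq`** — THE SUM RULE: `∫_a^b β σ²(β,t) dt = m(β,b) − m(β,a)` for `0 < a ≤ b`
  (the fundamental theorem of calculus for RIGHT derivatives, Mathlib `integral_eq_sub_of_hasDeriv_right_of_le`);
  `integral_mul_tsum_plusTruncated_le` — `∫_a^b β σ²(β,t) dt ≤ m(β,b) − m*(β) ≤ 1 − m*(β)` uniformly in `a > 0`.

## References

* R. S. Ellis, *Entropy, Large Deviations, and Statistical Mechanics*, Springer (1985/2006), Lemma V.7.4, eq. (5.28),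
  Thm. V.7.2 (b). [Ellis2006]
* S. Friedli, Y. Velenik, *Statistical Mechanics of Lattice Systems*, CUP (2017), Remark 3.41, Exercise 3.34,
  §3.7.4. [FriedliVelenik2017]
-/

noncomputable section

namespace Summit.CriticalPhenomena.PercolationContinuityZ3.Theorems.FK

namespace IsingSusceptibility

open MeasureTheory Filter Topology Finset Set intervalIntegral
open scoped symmDiff
open Literature.Probability.LatticeModels
open Summit.CriticalPhenomena.PercolationContinuityZ3.Theorems.FK.IsingCLT

variable {d : ℕ}

/-! ### The sharp GHS bound on the susceptibility in a field -/

/-- **`β σ²(β,h) ≤ (m(β,h) − m*(β))/h`** for `β > 0`, `h > 0`: the lower chord bound `le_slope_magnetizationInField` at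
the pair `(0,h)` (`m(β,0) = m*(β)`). [cite: FriedliVelenik2017, Remark 3.41; Ellis2006, Lemma V.7.4] -/
theorem mul_tsum_plusTruncated_le_slope {β h : ℝ} (hβ : 0 < β) (hh : 0 < h) :
    β * ∑' z : Site d, (plusCorr d β h ({0} ∆ {z}) - plusCorr d β h {0} * plusCorr d β h {z}) ≤
      (magnetizationInField d β h - spontaneousMagnetization d β) / h := by
  have := le_slope_magnetizationInField (d := d) hβ le_rfl hh
  rwa [slope_def_field, magnetizationInField_zero, sub_zero] at this

/-- **THE SHARP GHS SUSCEPTIBILITY BOUND `σ²(β,h) ≤ (m(β,h) − m*(β))/(β h)`** (`β > 0`, `h > 0`).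
[cite: FriedliVelenik2017, Remark 3.41; Ellis2006, Thm. V.7.2 (b)] -/
theorem tsum_plusTruncated_le_sub_div {β h : ℝ} (hβ : 0 < β) (hh : 0 < h) :
    ∑' z : Site d, (plusCorr d β h ({0} ∆ {z}) - plusCorr d β h {0} * plusCorr d β h {z}) ≤
      (magnetizationInField d β h - spontaneousMagnetization d β) / (β * h) := by
  rw [le_div_iff₀ (mul_pos hβ hh)]
  have := mul_tsum_plusTruncated_le_slope (d := d) hβ hh
  rw [le_div_iff₀ hh] at this
  linarith

/-- **`σ²(β,h) ≤ (1 − m*(β))/(β h) ≤ 1/(βh)`** (`β > 0`, `h > 0`; `m(β,h) ≤ 1`). [cite: Ellis2006, Thm. V.7.2 (b)] -/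
theorem tsum_plusTruncated_le_one_sub_div {β h : ℝ} (hβ : 0 < β) (hh : 0 < h) :
    ∑' z : Site d, (plusCorr d β h ({0} ∆ {z}) - plusCorr d β h {0} * plusCorr d β h {z}) ≤
      (1 - spontaneousMagnetization d β) / (β * h) := by
  refine (tsum_plusTruncated_le_sub_div hβ hh).trans (div_le_div_of_nonneg_right ?_ (mul_pos hβ hh).le)
  have hm : magnetizationInField d β h = plusCorr d β h {0} := by
    simp only [magnetizationInField, plusCorr, spinProduct_singleton]
  linarith [plusCorr_le_one (d := d) hβ.le hh.le {0}]

/-- **`h ↦ (m(β,h) − m*(β))/h` is nonincreasing on `(0,∞)`** (`β ≥ 0`; chords of a concave function from its left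
endpoint). [cite: FriedliVelenik2017, Remark 3.41] -/
theorem antitoneOn_slope_magnetizationInField_zero {β : ℝ} (hβ : 0 ≤ β) :
    AntitoneOn (fun h => (magnetizationInField d β h - spontaneousMagnetization d β) / h) (Ioi 0) := by
  have h := (concaveOn_magnetizationInField (d := d) hβ).antitoneOn_slope_gt (mem_Ici.2 (le_refl (0 : ℝ)))
  have hset : {y : ℝ | y ∈ Set.Ici (0 : ℝ) ∧ 0 < y} = Set.Ioi 0 :=
    Set.ext fun y => ⟨fun hy => hy.2, fun hy => ⟨Set.mem_Ici.2 (le_of_lt hy), hy⟩⟩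
  rw [hset] at h
  refine h.congr fun y _ => ?_
  rw [slope_def_field, magnetizationInField_zero, sub_zero]

/-! ### The sum rule -/

/-- `σ²(β,·)` is integrable on every compact interval of `(0,∞)` (it is nonincreasing there). [cite: Ellis2006, Lemma V.7.3 (b)] -/
theorem intervalIntegrable_tsum_plusTruncated {β a b : ℝ} (hβ : 0 < β) (ha : 0 < a) (hb : 0 < b) :
    IntervalIntegrable (fun t => ∑' z : Site d, (plusCorr d β t ({0} ∆ {z}) - plusCorr d β t {0} * plusCorr d β t {z}))
      volume a b := by
  refine ((antitoneOn_tsum_plusTruncated (d := d) hβ).mono fun t ht => ?_).intervalIntegrable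
  rcases le_total a b with hab | hab
  · rw [uIcc_of_le hab] at ht; exact ha.trans_le ht.1
  · rw [uIcc_of_ge hab] at ht; exact hb.trans_le ht.1

/-- **THE SUSCEPTIBILITY SUM RULE**: for `β > 0` and `0 < a ≤ b`,
`∫_a^b β σ²(β,t) dt = m(β,b) − m(β,a)` — the fluctuation–response theorem integrated (fundamental theorem of
calculus for the right derivative `∂⁺m/∂h = β σ²`, `m(β,·)` continuous on `(0,∞)`).
[cite: Ellis2006, Lemma V.7.4, eq. (5.28); FriedliVelenik2017, §3.7.4] -/
theorem integral_mul_tsum_plusTruncated_eq {β a b : ℝ} (hβ : 0 < β) (ha : 0 < a) (hab : a ≤ b) :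
    ∫ t in a..b, β * ∑' z : Site d, (plusCorr d β t ({0} ∆ {z}) - plusCorr d β t {0} * plusCorr d β t {z}) =
      magnetizationInField d β b - magnetizationInField d β a := by
  have hcont : ContinuousOn (fun t => magnetizationInField d β t) (Icc a b) := by
    have := (concaveOn_magnetizationInField (d := d) hβ.le).continuousOn_interior
    rw [interior_Ici] at this
    exact this.mono fun t ht => ha.trans_le ht.1
  refine integral_eq_sub_of_hasDeriv_right_of_le hab hcont (fun t ht => ?_) ?_
  · exact (hasDerivWithinAt_magnetizationInField_Ici_of_pos hβ (ha.trans ht.1)).mono Ioi_subset_Ici_self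
  · exact (intervalIntegrable_tsum_plusTruncated hβ ha (ha.trans_le hab)).const_mul β

/-- **`∫_a^b β σ²(β,t) dt ≤ m(β,b) − m*(β) ≤ 1 − m*(β)`** uniformly in `0 < a ≤ b` (`m(β,a) ≥ m*(β)`).
[cite: Ellis2006, Lemma V.7.4] -/
theorem integral_mul_tsum_plusTruncated_le {β a b : ℝ} (hβ : 0 < β) (ha : 0 < a) (hab : a ≤ b) :
    ∫ t in a..b, β * ∑' z : Site d, (plusCorr d β t ({0} ∆ {z}) - plusCorr d β t {0} * plusCorr d β t {z}) ≤
      magnetizationInField d β b - spontaneousMagnetization d β := by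
  rw [integral_mul_tsum_plusTruncated_eq hβ ha hab, ← magnetizationInField_zero]
  linarith [monotoneOn_magnetizationInField (d := d) hβ.le (mem_Ici.2 le_rfl) (mem_Ici.2 ha.le) ha.le]

end IsingSusceptibility

end Summit.CriticalPhenomena.PercolationContinuityZ3.Theorems.FK

end
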